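import Mathlib
import Summits.ValiantsHypothesis.ValiantsHypothesis.Theorems.NewtonUnitEquationsDissociatedUniformTotalsLaw
import Summits.ValiantsHypothesis.ValiantsHypothesis.Theorems.NewtonUnitEquationsDissociatedUniformTotalsLawShallow
import Literature.Computability.AlgebraicComplexity.NewtonPolygonTauProductBounds
import HarnessLib

/-!
# Crux `NewtonUnitEquations.DissociatedUniform` (stmt-ValiantsHypothesis-5905): the `n = 3` totals law — the SHALLOW/DEEP DICHOTOMY
# `T ≤ (V_P + V_Q + V_R) + |G|(V(A) + V(B) + V(C)) + 12|G| + #deep`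

Companion of `…TotalsLawShallow` (`sum_card_shallow_le`: the `c`-shallow hull vertices of the classes number at most
`V_P + |G|·V(C) + 4|G|` in total, for `c` injective and arbitrary `a, b`).  Here the symmetric roles of the three letters are cashed:
* `classImage_rotate` — the class finset of `(a, b, c)` is that of `(b, c, a)` (the tree's `classPts_rotate` at finset level), and an
  `a`-shallow spelling for `(a, b, c)` is a third-letter-shallow spelling for `(b, c, a)` (`card_shallowA_le`, `card_shallowB_le`);
* **`sum_card_shallowA_le` / `sum_card_shallowB_le`** — `∑_s #{a-shallow} ≤ V_Q + |G|V(A) + 4|G|`, `∑_s #{b-shallow} ≤ V_R + |G|V(B) + 4|G|`;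
* **`totalVert_le_shallow_add_deep`** — for `a, b, c` injective,
  `T ≤ (V_P + V_Q + V_R) + |G|·(V(A) + V(B) + V(C)) + 12|G| + ∑_s #deep(s)`, where a hull vertex of class `s` is DEEP if at no chart
  weight `(±1, t)` exposing it does any spelling `a x + b y + c z` of it have a letter that tops its own alphabet; coarse form
  `T ≤ 6|G|² + 12|G| + ∑_s #deep(s)` (`totalVert_le_sq_add_deep`);
* **`totalVert_le_of_no_deep`** — no deep vertex anywhere ⇒ `T ≤ 6|G|² + 12|G|` (the `n = 3` law with constant `6 + o(1)` on the
  whole "no deep vertex" stratum, which contains both extreme regimes and, in the census, all random configurations).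
So **`TotalsLawThree` is equivalent to a bound `∑_s #deep(s) = O(|G|²)`** (memo `Cruxes/DissociatedUniform/NOTES-t1g11.md` §4: one
class can hold `≈ q²/4` deep vertices — the parabola gadget — while all probes give `∑_s #deep ≤ 0.25·q²`).
Honest label: unconditional structure theorems; the law itself remains OPEN; nothing here bears on VP ≠ VNP.
[folklore]
-/

set_option linter.dupNamespace false -- `ValiantsHypothesis.ValiantsHypothesis` (summit = problem) in every name

open scoped BigOperators
open Matrix Finset

namespace Summit.ValiantsHypothesis.ValiantsHypothesis.Theorems.NewtonUnitEquationsDissociatedUniform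

namespace TotalsLaw

open Literature.Computability.AlgebraicComplexity.KPTT.PlanarMinkowski

variable {G : Type*} [AddCommGroup G] [Fintype G]

/-! ### Rotating the letters at finset level -/

omit [Fintype G] in
open Classical in
/-- The class finset is invariant under rotating the letters: `F(a,b,c) s = F(b,c,a) s`. [folklore] -/
theorem classImage_rotate [Fintype G] (a b c : G → (Fin 2 → ℝ)) (s : G) :
    (Finset.univ.image fun p : G × G => a p.1 + b p.2 + c (s - p.1 - p.2)) =
      Finset.univ.image fun p : G × G => b p.1 + c p.2 + a (s - p.1 - p.2) := by
  apply Finset.coe_injective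
  rw [Finset.coe_image, Finset.coe_image, Finset.coe_univ, Set.image_univ, Set.image_univ]
  exact classPts_rotate a b c s

/-! ### `a`-shallow and `b`-shallow vertices via the third-letter theorem -/

open Classical in
/-- **`a`-shallow vertices, one class**: an `a`-shallow spelling of a vertex of class `s` of `(a,b,c)` is a third-letter-shallow
spelling of the same vertex of the same class of `(b,c,a)`. [folklore] -/
theorem card_shallowA_le (a b c : G → (Fin 2 → ℝ)) (s : G) :
    ((Finset.univ.image fun p : G × G => a p.1 + b p.2 + c (s - p.1 - p.2)).filter fun v =>
        ∃ σ t : ℝ, (σ = 1 ∨ σ = -1) ∧ ∃ p : G × G, a p.1 + b p.2 + c (s - p.1 - p.2) = v ∧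
          IsStrictTop ![σ, t] (Finset.univ.image fun p : G × G => a p.1 + b p.2 + c (s - p.1 - p.2)) v ∧
          IsStrictTop ![σ, t] (Finset.univ.image a) (a p.1)).card ≤
      ((Finset.univ.image fun p : G × G => b p.1 + c p.2 + a (s - p.1 - p.2)).filter fun v =>
        ∃ σ t : ℝ, (σ = 1 ∨ σ = -1) ∧ ∃ p : G × G, b p.1 + c p.2 + a (s - p.1 - p.2) = v ∧
          IsStrictTop ![σ, t] (Finset.univ.image fun p : G × G => b p.1 + c p.2 + a (s - p.1 - p.2)) v ∧
          IsStrictTop ![σ, t] (Finset.univ.image a) (a (s - p.1 - p.2))).card := by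
  refine Finset.card_le_card fun v hv => ?_
  rw [← classImage_rotate a b c s]
  obtain ⟨hvF, σ, t, hσ, ⟨x, y⟩, hp, htop, hA⟩ := Finset.mem_filter.1 hv
  refine Finset.mem_filter.2 ⟨hvF, σ, t, hσ, (y, s - x - y), ?_, htop, ?_⟩
  · rw [← hp]
    have : s - y - (s - x - y) = x := by abel
    simp only [this]
    abel
  · have : s - y - (s - x - y) = x := by abel
    simp only [this]
    exact hA

open Classical in
/-- **`b`-shallow vertices, one class**: a `b`-shallow spelling for `(a,b,c)` is a third-letter-shallow spelling for `(c,a,b)`.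
[folklore] -/
theorem card_shallowB_le (a b c : G → (Fin 2 → ℝ)) (s : G) :
    ((Finset.univ.image fun p : G × G => a p.1 + b p.2 + c (s - p.1 - p.2)).filter fun v =>
        ∃ σ t : ℝ, (σ = 1 ∨ σ = -1) ∧ ∃ p : G × G, a p.1 + b p.2 + c (s - p.1 - p.2) = v ∧
          IsStrictTop ![σ, t] (Finset.univ.image fun p : G × G => a p.1 + b p.2 + c (s - p.1 - p.2)) v ∧
          IsStrictTop ![σ, t] (Finset.univ.image b) (b p.2)).card ≤
      ((Finset.univ.image fun p : G × G => c p.1 + a p.2 + b (s - p.1 - p.2)).filter fun v =>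
        ∃ σ t : ℝ, (σ = 1 ∨ σ = -1) ∧ ∃ p : G × G, c p.1 + a p.2 + b (s - p.1 - p.2) = v ∧
          IsStrictTop ![σ, t] (Finset.univ.image fun p : G × G => c p.1 + a p.2 + b (s - p.1 - p.2)) v ∧
          IsStrictTop ![σ, t] (Finset.univ.image b) (b (s - p.1 - p.2))).card := by
  refine Finset.card_le_card fun v hv => ?_
  have hrot : (Finset.univ.image fun p : G × G => a p.1 + b p.2 + c (s - p.1 - p.2)) =
      Finset.univ.image fun p : G × G => c p.1 + a p.2 + b (s - p.1 - p.2) := by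
    rw [classImage_rotate a b c s, classImage_rotate b c a s]
  rw [← hrot]
  obtain ⟨hvF, σ, t, hσ, ⟨x, y⟩, hp, htop, hB⟩ := Finset.mem_filter.1 hv
  refine Finset.mem_filter.2 ⟨hvF, σ, t, hσ, (s - x - y, x), ?_, htop, ?_⟩
  · rw [← hp]
    have : s - (s - x - y) - x = y := by abel
    simp only [this]
    abel
  · have : s - (s - x - y) - x = y := by abel
    simp only [this]
    exact hB

open Classical in
/-- **`∑_s #{a-shallow vertices} ≤ V_Q + |G|·V(A) + 4|G|`** for `a` injective (`V_Q = fibreTotal b c`). [folklore] -/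
theorem sum_card_shallowA_le (a b c : G → (Fin 2 → ℝ)) (ha : Function.Injective a) :
    ∑ s, ((Finset.univ.image fun p : G × G => a p.1 + b p.2 + c (s - p.1 - p.2)).filter fun v =>
        ∃ σ t : ℝ, (σ = 1 ∨ σ = -1) ∧ ∃ p : G × G, a p.1 + b p.2 + c (s - p.1 - p.2) = v ∧
          IsStrictTop ![σ, t] (Finset.univ.image fun p : G × G => a p.1 + b p.2 + c (s - p.1 - p.2)) v ∧
          IsStrictTop ![σ, t] (Finset.univ.image a) (a p.1)).card ≤
      fibreTotal b c + Fintype.card G * ((convexHull ℝ (Set.range a)).extremePoints ℝ).ncard + 4 * Fintype.card G :=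
  (Finset.sum_le_sum fun s _ => card_shallowA_le a b c s).trans (sum_card_shallow_le b c a ha)

open Classical in
/-- **`∑_s #{b-shallow vertices} ≤ V_R + |G|·V(B) + 4|G|`** for `b` injective (`V_R = fibreTotal c a`). [folklore] -/
theorem sum_card_shallowB_le (a b c : G → (Fin 2 → ℝ)) (hb : Function.Injective b) :
    ∑ s, ((Finset.univ.image fun p : G × G => a p.1 + b p.2 + c (s - p.1 - p.2)).filter fun v =>
        ∃ σ t : ℝ, (σ = 1 ∨ σ = -1) ∧ ∃ p : G × G, a p.1 + b p.2 + c (s - p.1 - p.2) = v ∧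
          IsStrictTop ![σ, t] (Finset.univ.image fun p : G × G => a p.1 + b p.2 + c (s - p.1 - p.2)) v ∧
          IsStrictTop ![σ, t] (Finset.univ.image b) (b p.2)).card ≤
      fibreTotal c a + Fintype.card G * ((convexHull ℝ (Set.range b)).extremePoints ℝ).ncard + 4 * Fintype.card G :=
  (Finset.sum_le_sum fun s _ => card_shallowB_le a b c s).trans (sum_card_shallow_le c a b hb)

/-! ### The dichotomy -/

open Classical in
/-- **`T ≤ (V_P + V_Q + V_R) + |G|(V(A) + V(B) + V(C)) + 12|G| + ∑_s #deep(s)`** for injective letters: every hull vertex of a class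
is a chart top (`mem_extremePoints_iff_charts`), hence `a`-shallow, `b`-shallow, `c`-shallow or DEEP (none of the three), and the
three shallow families are bounded by `…TotalsLawShallow.sum_card_shallow_le` and its rotations. [folklore] -/
theorem totalVert_le_shallow_add_deep (a b c : G → (Fin 2 → ℝ)) (ha : Function.Injective a) (hb : Function.Injective b)
    (hc : Function.Injective c) :
    totalVert a b c ≤
      (fibreTotal a b + fibreTotal b c + fibreTotal c a) +
      Fintype.card G * (((convexHull ℝ (Set.range a)).extremePoints ℝ).ncard +
        ((convexHull ℝ (Set.range b)).extremePoints ℝ).ncard + ((convexHull ℝ (Set.range c)).extremePoints ℝ).ncard) +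
      12 * Fintype.card G +
      ∑ s, ((Finset.univ.image fun p : G × G => a p.1 + b p.2 + c (s - p.1 - p.2)).filter fun v =>
        v ∈ (convexHull ℝ (classPts a b c s)).extremePoints ℝ ∧
        ¬ (∃ σ t : ℝ, (σ = 1 ∨ σ = -1) ∧ ∃ p : G × G, a p.1 + b p.2 + c (s - p.1 - p.2) = v ∧
          IsStrictTop ![σ, t] (Finset.univ.image fun p : G × G => a p.1 + b p.2 + c (s - p.1 - p.2)) v ∧
          (IsStrictTop ![σ, t] (Finset.univ.image a) (a p.1) ∨ IsStrictTop ![σ, t] (Finset.univ.image b) (b p.2) ∨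
            IsStrictTop ![σ, t] (Finset.univ.image c) (c (s - p.1 - p.2))))).card := by
  classical
  have hA := sum_card_shallowA_le a b c ha
  have hB := sum_card_shallowB_le a b c hb
  have hC := sum_card_shallow_le a b c hc
  -- per class: vertices ⊆ shallowA ∪ shallowB ∪ shallowC ∪ deep
  have hcl : ∀ s : G, classVert a b c s ≤
      ((Finset.univ.image fun p : G × G => a p.1 + b p.2 + c (s - p.1 - p.2)).filter fun v =>
        ∃ σ t : ℝ, (σ = 1 ∨ σ = -1) ∧ ∃ p : G × G, a p.1 + b p.2 + c (s - p.1 - p.2) = v ∧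
          IsStrictTop ![σ, t] (Finset.univ.image fun p : G × G => a p.1 + b p.2 + c (s - p.1 - p.2)) v ∧
          IsStrictTop ![σ, t] (Finset.univ.image a) (a p.1)).card +
      ((Finset.univ.image fun p : G × G => a p.1 + b p.2 + c (s - p.1 - p.2)).filter fun v =>
        ∃ σ t : ℝ, (σ = 1 ∨ σ = -1) ∧ ∃ p : G × G, a p.1 + b p.2 + c (s - p.1 - p.2) = v ∧
          IsStrictTop ![σ, t] (Finset.univ.image fun p : G × G => a p.1 + b p.2 + c (s - p.1 - p.2)) v ∧
          IsStrictTop ![σ, t] (Finset.univ.image b) (b p.2)).card +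
      ((Finset.univ.image fun p : G × G => a p.1 + b p.2 + c (s - p.1 - p.2)).filter fun v =>
        ∃ σ t : ℝ, (σ = 1 ∨ σ = -1) ∧ ∃ p : G × G, a p.1 + b p.2 + c (s - p.1 - p.2) = v ∧
          IsStrictTop ![σ, t] (Finset.univ.image fun p : G × G => a p.1 + b p.2 + c (s - p.1 - p.2)) v ∧
          IsStrictTop ![σ, t] (Finset.univ.image c) (c (s - p.1 - p.2))).card +
      ((Finset.univ.image fun p : G × G => a p.1 + b p.2 + c (s - p.1 - p.2)).filter fun v =>
        v ∈ (convexHull ℝ (classPts a b c s)).extremePoints ℝ ∧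
        ¬ (∃ σ t : ℝ, (σ = 1 ∨ σ = -1) ∧ ∃ p : G × G, a p.1 + b p.2 + c (s - p.1 - p.2) = v ∧
          IsStrictTop ![σ, t] (Finset.univ.image fun p : G × G => a p.1 + b p.2 + c (s - p.1 - p.2)) v ∧
          (IsStrictTop ![σ, t] (Finset.univ.image a) (a p.1) ∨ IsStrictTop ![σ, t] (Finset.univ.image b) (b p.2) ∨
            IsStrictTop ![σ, t] (Finset.univ.image c) (c (s - p.1 - p.2))))).card := by
    intro s
    set F := Finset.univ.image fun p : G × G => a p.1 + b p.2 + c (s - p.1 - p.2) with hF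
    have hcoe : (F : Set (Fin 2 → ℝ)) = classPts a b c s := by
      rw [hF, Finset.coe_image, Finset.coe_univ, Set.image_univ]; rfl
    set SA := F.filter fun v => ∃ σ t : ℝ, (σ = 1 ∨ σ = -1) ∧ ∃ p : G × G, a p.1 + b p.2 + c (s - p.1 - p.2) = v ∧
      IsStrictTop ![σ, t] F v ∧ IsStrictTop ![σ, t] (Finset.univ.image a) (a p.1) with hSA
    set SB := F.filter fun v => ∃ σ t : ℝ, (σ = 1 ∨ σ = -1) ∧ ∃ p : G × G, a p.1 + b p.2 + c (s - p.1 - p.2) = v ∧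
      IsStrictTop ![σ, t] F v ∧ IsStrictTop ![σ, t] (Finset.univ.image b) (b p.2) with hSB
    set SC := F.filter fun v => ∃ σ t : ℝ, (σ = 1 ∨ σ = -1) ∧ ∃ p : G × G, a p.1 + b p.2 + c (s - p.1 - p.2) = v ∧
      IsStrictTop ![σ, t] F v ∧ IsStrictTop ![σ, t] (Finset.univ.image c) (c (s - p.1 - p.2)) with hSC
    set D := F.filter fun v => v ∈ (convexHull ℝ (classPts a b c s)).extremePoints ℝ ∧
      ¬ (∃ σ t : ℝ, (σ = 1 ∨ σ = -1) ∧ ∃ p : G × G, a p.1 + b p.2 + c (s - p.1 - p.2) = v ∧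
        IsStrictTop ![σ, t] F v ∧
        (IsStrictTop ![σ, t] (Finset.univ.image a) (a p.1) ∨ IsStrictTop ![σ, t] (Finset.univ.image b) (b p.2) ∨
          IsStrictTop ![σ, t] (Finset.univ.image c) (c (s - p.1 - p.2)))) with hD
    have hsub : (convexHull ℝ (classPts a b c s)).extremePoints ℝ ⊆ ((SA ∪ SB ∪ SC ∪ D : Finset (Fin 2 → ℝ)) : Set (Fin 2 → ℝ)) := by
      intro v hv
      have hvF : v ∈ F := by rw [← Finset.mem_coe, hcoe]; exact extremePoints_convexHull_subset hv
      rw [Finset.coe_union, Finset.coe_union, Finset.coe_union]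
      simp only [Set.mem_union, Finset.mem_coe]
      by_cases h : ∃ σ t : ℝ, (σ = 1 ∨ σ = -1) ∧ ∃ p : G × G, a p.1 + b p.2 + c (s - p.1 - p.2) = v ∧
          IsStrictTop ![σ, t] F v ∧
          (IsStrictTop ![σ, t] (Finset.univ.image a) (a p.1) ∨ IsStrictTop ![σ, t] (Finset.univ.image b) (b p.2) ∨
            IsStrictTop ![σ, t] (Finset.univ.image c) (c (s - p.1 - p.2)))
      · obtain ⟨σ, t, hσ, p, hp, htop, hl | hl | hl⟩ := h
        · exact Or.inl (Or.inl (Or.inl (Finset.mem_filter.2 ⟨hvF, σ, t, hσ, p, hp, htop, hl⟩)))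
        · exact Or.inl (Or.inl (Or.inr (Finset.mem_filter.2 ⟨hvF, σ, t, hσ, p, hp, htop, hl⟩)))
        · exact Or.inl (Or.inr (Finset.mem_filter.2 ⟨hvF, σ, t, hσ, p, hp, htop, hl⟩))
      · exact Or.inr (Finset.mem_filter.2 ⟨hvF, hv, h⟩)
    unfold classVert
    calc ((convexHull ℝ (classPts a b c s)).extremePoints ℝ).ncard
        ≤ (((SA ∪ SB ∪ SC ∪ D : Finset (Fin 2 → ℝ))) : Set (Fin 2 → ℝ)).ncard :=
          Set.ncard_le_ncard hsub (Finset.finite_toSet _)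
      _ = (SA ∪ SB ∪ SC ∪ D).card := Set.ncard_coe_finset _
      _ ≤ (SA ∪ SB ∪ SC).card + D.card := Finset.card_union_le _ _
      _ ≤ (SA ∪ SB).card + SC.card + D.card := Nat.add_le_add_right (Finset.card_union_le _ _) _
      _ ≤ SA.card + SB.card + SC.card + D.card :=
          Nat.add_le_add_right (Nat.add_le_add_right (Finset.card_union_le _ _) _) _
  unfold totalVert
  calc ∑ s, classVert a b c s ≤ _ := Finset.sum_le_sum fun s _ => hcl s
    _ ≤ _ := by
        rw [Finset.sum_add_distrib, Finset.sum_add_distrib, Finset.sum_add_distrib]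
        have := add_le_add (add_le_add hA hB) hC
        linarith [this]

open Classical in
/-- `V(·) ≤ |G|` for each alphabet and `V_X ≤ |G|²` for each fibre system give the coarse form
**`T ≤ 6|G|² + 12|G| + ∑_s #deep(s)`**. [folklore] -/
theorem totalVert_le_sq_add_deep (a b c : G → (Fin 2 → ℝ)) (ha : Function.Injective a) (hb : Function.Injective b)
    (hc : Function.Injective c) :
    totalVert a b c ≤ 6 * Fintype.card G ^ 2 + 12 * Fintype.card G +
      ∑ s, ((Finset.univ.image fun p : G × G => a p.1 + b p.2 + c (s - p.1 - p.2)).filter fun v =>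
        v ∈ (convexHull ℝ (classPts a b c s)).extremePoints ℝ ∧
        ¬ (∃ σ t : ℝ, (σ = 1 ∨ σ = -1) ∧ ∃ p : G × G, a p.1 + b p.2 + c (s - p.1 - p.2) = v ∧
          IsStrictTop ![σ, t] (Finset.univ.image fun p : G × G => a p.1 + b p.2 + c (s - p.1 - p.2)) v ∧
          (IsStrictTop ![σ, t] (Finset.univ.image a) (a p.1) ∨ IsStrictTop ![σ, t] (Finset.univ.image b) (b p.2) ∨
            IsStrictTop ![σ, t] (Finset.univ.image c) (c (s - p.1 - p.2))))).card := by
  classical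
  have h := totalVert_le_shallow_add_deep a b c ha hb hc
  have h1 : fibreTotal a b ≤ Fintype.card G ^ 2 := fibreTotal_le_card_sq a b
  have h2 : fibreTotal b c ≤ Fintype.card G ^ 2 := fibreTotal_le_card_sq b c
  have h3 : fibreTotal c a ≤ Fintype.card G ^ 2 := fibreTotal_le_card_sq c a
  have h4 : Fintype.card G * (((convexHull ℝ (Set.range a)).extremePoints ℝ).ncard +
      ((convexHull ℝ (Set.range b)).extremePoints ℝ).ncard + ((convexHull ℝ (Set.range c)).extremePoints ℝ).ncard) ≤
      3 * Fintype.card G ^ 2 := by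
    have ea := ncard_extremePoints_range_le a
    have eb := ncard_extremePoints_range_le b
    have ec := ncard_extremePoints_range_le c
    calc _ ≤ Fintype.card G * (Fintype.card G + Fintype.card G + Fintype.card G) := Nat.mul_le_mul_left _ (by omega)
      _ = 3 * Fintype.card G ^ 2 := by ring
  omega

open Classical in
/-- **No deep vertex ⇒ `T ≤ 6|G|² + 12|G|`.**  If every hull vertex of every class has, at some chart weight exposing it, a spelling
with a letter that tops its own alphabet, the `n = 3` totals law holds with constant `6 + o(1)`. [folklore] -/
theorem totalVert_le_of_no_deep (a b c : G → (Fin 2 → ℝ)) (ha : Function.Injective a) (hb : Function.Injective b)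
    (hc : Function.Injective c)
    (hnodeep : ∀ (s : G) (v : Fin 2 → ℝ), v ∈ (convexHull ℝ (classPts a b c s)).extremePoints ℝ →
      ∃ σ t : ℝ, (σ = 1 ∨ σ = -1) ∧ ∃ p : G × G, a p.1 + b p.2 + c (s - p.1 - p.2) = v ∧
        IsStrictTop ![σ, t] (Finset.univ.image fun p : G × G => a p.1 + b p.2 + c (s - p.1 - p.2)) v ∧
        (IsStrictTop ![σ, t] (Finset.univ.image a) (a p.1) ∨ IsStrictTop ![σ, t] (Finset.univ.image b) (b p.2) ∨
          IsStrictTop ![σ, t] (Finset.univ.image c) (c (s - p.1 - p.2)))) :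
    totalVert a b c ≤ 6 * Fintype.card G ^ 2 + 12 * Fintype.card G := by
  classical
  have h := totalVert_le_sq_add_deep a b c ha hb hc
  have hzero : ∀ s : G, ((Finset.univ.image fun p : G × G => a p.1 + b p.2 + c (s - p.1 - p.2)).filter fun v =>
        v ∈ (convexHull ℝ (classPts a b c s)).extremePoints ℝ ∧
        ¬ (∃ σ t : ℝ, (σ = 1 ∨ σ = -1) ∧ ∃ p : G × G, a p.1 + b p.2 + c (s - p.1 - p.2) = v ∧
          IsStrictTop ![σ, t] (Finset.univ.image fun p : G × G => a p.1 + b p.2 + c (s - p.1 - p.2)) v ∧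
          (IsStrictTop ![σ, t] (Finset.univ.image a) (a p.1) ∨ IsStrictTop ![σ, t] (Finset.univ.image b) (b p.2) ∨
            IsStrictTop ![σ, t] (Finset.univ.image c) (c (s - p.1 - p.2))))).card = 0 := by
    intro s
    rw [Finset.card_eq_zero, Finset.filter_eq_empty_iff]
    intro v _ hv
    exact hv.2 (hnodeep s v hv.1)
  simp only [hzero, Finset.sum_const_zero, add_zero] at h
  exact h

end TotalsLaw

end Summit.ValiantsHypothesis.ValiantsHypothesis.Theorems.NewtonUnitEquationsDissociatedUniform
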